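import Literature.NumberTheory.Automorphic.RestrictedTensorProductLocalTransport
import HarnessLib

/-!
# Restricted tensor products: gluing local ISOMORPHISM CLASSES when the fixed lines are one-dimensional
(Flath 1979, §2, Example 2 and the Remark following it)

Topic `NumberTheory/Automorphic`; namespace `Literature.NumberTheory.Automorphic`.  Theorems only (no definition, no named
fact, no `sorry`).

★ `IsRestrictedTensorProductRep.exists_equiv_of_forall_equiv` glues local equivalences `e i : V i ≃ V' i` into an
equivariant `⊗' V i ≃ ⊗' V' i` provided the base vectors are matched UP TO UNITS for almost all `i`.  When the local
representations are only known to be ISOMORPHIC (an `∃` with no control of the base vectors — the situation of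
[Liu2021, Lemma D.1 (4)]: member-wise isomorphic local factors of two `θ`-packages), that proviso is AUTOMATIC as soon as,
for almost all `i`, the `K i`-fixed vectors of `V' i` lie on a line and both base vectors are non-zero: an intertwining
equivalence carries the `K i`-fixed base vector `x₀ i` to a non-zero `K i`-fixed vector, hence to a unit multiple of `x₀' i`
(Flath's Remark: spherical representations, `dim V_v^{K_v} = 1`).  This file records that step over a field `k`:

* `IsRestrictedTensorProductRep.exists_equiv_of_forall_equiv_of_fixedPoints_line` — local equivalences + «the `K i`-fixed
  vectors of `ρ' i` are pairwise proportional» a.e. + non-zero base vectors a.e. ⇒ `π ≅ π'` equivariantly;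
* `IsRestrictedTensorProductRep.exists_equiv_of_forall_equiv_of_finrank_fixedPoints_eq_one` — the same with the line
  condition stated as `finrank k (V' i)^{K i} = 1` a.e.;
* `IsRestrictedTensorProductRep.exists_equiv_of_forall_exists_equiv_of_finrank_fixedPoints_eq_one` — the same from mere
  ISOMORPHISM CLASSES `∀ i, ∃ f : V i ≃ V' i` intertwining (the shape of the tree's `AreIsomorphicRep`), by choice.

Consumer (cell hodgecm-mathlib, P5 row R2′-c «`⊗'` assembly of member-wise local isos»): with the `⊗'` sockets of the
`θ`-package (★ `exists_isRestrictedTensorProductRep_chiSplittingLine_omegaPi_center`) this turns «`Θ_v(j) ≅ Θ_v(i)` for all `v`»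
plus «`dim Θ_v(i)^{K_v} = 1` for almost all `v`» into an equivariant isomorphism of the finite-adelic carriers.  HC_CM is
proved only modulo the printed citations until rung 0 closes; this file proves no cell binder.

## References
* [Flath1979] D. Flath, *Decomposition of representations into tensor products*, Proc. Sympos. Pure Math. 33 (1979),
  part 1, 179–183, §2: Theorem 2, Example 2 and the Remark following it.
* [Bump1997] D. Bump, *Automorphic forms and representations* (1997), §3.4 (Thm. 3.4.4 ff.: spherical a.e., `dim = 1`).
-/

set_option autoImplicit false

open scoped RestrictedProduct
open Filter

namespace Literature.NumberTheory.Automorphic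

universe u uk uG v v' w w'

variable {ι : Type u} {k : Type uk} [Field k] {G : ι → Type uG} [∀ i, Group (G i)] {K : ∀ i, Subgroup (G i)}
  {V : ι → Type v} [∀ i, AddCommGroup (V i)] [∀ i, Module k (V i)]
  {V' : ι → Type v'} [∀ i, AddCommGroup (V' i)] [∀ i, Module k (V' i)]
  {ρ : ∀ i, Representation k (G i) (V i)} {ρ' : ∀ i, Representation k (G i) (V' i)}
  {x₀ : ∀ i, V i} {x₀' : ∀ i, V' i}

variable [DecidableEq ι] {W : Type w} [AddCommGroup W] [Module k W] {W' : Type w'} [AddCommGroup W'] [Module k W']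
  {π : Representation k (Πʳ i, [G i, K i]) W} {π' : Representation k (Πʳ i, [G i, K i]) W'}
  {hx₀ : ∀ᶠ i in cofinite, x₀ i ∈ (ρ i).fixedPoints (K i)}
  {hx₀' : ∀ᶠ i in cofinite, x₀' i ∈ (ρ' i).fixedPoints (K i)}
  {j : RestrictedFamily V x₀ → W} {j' : RestrictedFamily V' x₀' → W'} {S₀ S₀' : Finset ι}

/-- In a one-dimensional space every vector is a multiple of a given non-zero one — for the `K`-fixed SUBMODULE:
`finrank k F = 1`, `u ∈ F`, `u ≠ 0`, `w ∈ F` ⇒ `w = c • u`. [cite: Bump1997, §3.4 Thm. 3.4.4] -/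
theorem exists_smul_eq_of_mem_of_finrank_eq_one {M : Type*} [AddCommGroup M] [Module k M] {F : Submodule k M}
    (hF : Module.finrank k F = 1) {u : M} (hu : u ∈ F) (hu0 : u ≠ 0) {w : M} (hw : w ∈ F) :
    ∃ c : k, w = c • u := by
  have hu0' : (⟨u, hu⟩ : F) ≠ 0 := fun h0 => hu0 (congrArg Subtype.val h0)
  obtain ⟨c, hc⟩ := (finrank_eq_one_iff_of_nonzero' (⟨u, hu⟩ : F) hu0').1 hF ⟨w, hw⟩
  exact ⟨c, (congrArg Subtype.val hc).symm⟩

/-- **Gluing local equivalences when the fixed vectors lie on a line** (Flath 1979, §2, Example 2 with the Remark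
following it).  Let `(W, π, j) = ⊗' (ρ i, x₀ i)` and `(W', π', j') = ⊗' (ρ' i, x₀' i)` be restricted tensor products
over a field, `e i : V i ≃ V' i` intertwining equivalences, and assume that for almost all `i`: `x₀ i ≠ 0`, `x₀' i ≠ 0`,
and any two `K i`-fixed vectors of `ρ' i` with the first non-zero are proportional.  Then `π ≅ π'` equivariantly.
Indeed `e i (x₀ i)` is a NON-ZERO `K i`-fixed vector of `V' i` (transport of `hx₀`), so `x₀' i = c • e i (x₀ i)` with
`c ≠ 0`, a unit — the hypothesis of ★ `exists_equiv_of_forall_equiv`. [cite: Flath1979, §2 Remark following Example 2] -/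
theorem IsRestrictedTensorProductRep.exists_equiv_of_forall_equiv_of_fixedPoints_line
    (h : IsRestrictedTensorProductRep ρ π hx₀ j S₀) (h' : IsRestrictedTensorProductRep ρ' π' hx₀' j' S₀')
    (e : ∀ i, V i ≃ₗ[k] V' i) (he : ∀ i (g : G i) (v : V i), e i (ρ i g v) = ρ' i g (e i v))
    (hx₀ne : ∀ᶠ i in cofinite, x₀ i ≠ 0) (hx₀'ne : ∀ᶠ i in cofinite, x₀' i ≠ 0)
    (hline : ∀ᶠ i in cofinite, ∀ u ∈ (ρ' i).fixedPoints (K i), u ≠ 0 →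
      ∀ w ∈ (ρ' i).fixedPoints (K i), ∃ c : k, w = c • u) :
    ∃ E : W ≃ₗ[k] W', ∀ g : Πʳ i, [G i, K i], (E : W →ₗ[k] W') ∘ₗ π g = π' g ∘ₗ (E : W →ₗ[k] W') := by
  refine h.exists_equiv_of_forall_equiv h' e he ?_
  filter_upwards [hx₀, hx₀', hx₀ne, hx₀'ne, hline] with i hi hi' hne hne' hl
  have hfix : e i (x₀ i) ∈ (ρ' i).fixedPoints (K i) :=
    ((ρ' i).mem_fixedPoints (K i) _).2 fun g hg => by rw [← he, ((ρ i).mem_fixedPoints (K i) _).1 hi g hg]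
  have hne'' : e i (x₀ i) ≠ 0 := fun h0 => hne ((e i).map_eq_zero_iff.1 h0)
  obtain ⟨c, hc⟩ := hl _ hfix hne'' _ hi'
  have hc0 : c ≠ 0 := by
    rintro rfl
    exact hne' (by rw [hc, zero_smul])
  exact ⟨Units.mk0 c hc0, by rw [Units.smul_mk0]; exact hc⟩

/-- **Gluing local equivalences when the fixed lines are one-dimensional** (Flath 1979, §2, Remark following Example 2;
Bump §3.4: almost every local factor is spherical with `dim V_v^{K_v} = 1`): as
`exists_equiv_of_forall_equiv_of_fixedPoints_line`, with the line condition stated as `finrank k (V' i)^{K i} = 1` for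
almost all `i`. [cite: Flath1979, §2 Remark following Example 2] [cite: Bump1997, §3.4 Thm. 3.4.4] -/
theorem IsRestrictedTensorProductRep.exists_equiv_of_forall_equiv_of_finrank_fixedPoints_eq_one
    (h : IsRestrictedTensorProductRep ρ π hx₀ j S₀) (h' : IsRestrictedTensorProductRep ρ' π' hx₀' j' S₀')
    (e : ∀ i, V i ≃ₗ[k] V' i) (he : ∀ i (g : G i) (v : V i), e i (ρ i g v) = ρ' i g (e i v))
    (hx₀ne : ∀ᶠ i in cofinite, x₀ i ≠ 0) (hx₀'ne : ∀ᶠ i in cofinite, x₀' i ≠ 0)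
    (hrank : ∀ᶠ i in cofinite, Module.finrank k ((ρ' i).fixedPoints (K i)) = 1) :
    ∃ E : W ≃ₗ[k] W', ∀ g : Πʳ i, [G i, K i], (E : W →ₗ[k] W') ∘ₗ π g = π' g ∘ₗ (E : W →ₗ[k] W') :=
  h.exists_equiv_of_forall_equiv_of_fixedPoints_line h' e he hx₀ne hx₀'ne
    (hrank.mono fun _ hi _ hu hu0 _ hw => exists_smul_eq_of_mem_of_finrank_eq_one hi hu hu0 hw)

/-- **Gluing local ISOMORPHISM CLASSES** (Flath 1979, §2, Example 2 and Remark; the `AreIsomorphicRep` shape of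
[Liu2021, Lemma D.1 (4)]): if `(W, π, j) = ⊗' (ρ i, x₀ i)`, `(W', π', j') = ⊗' (ρ' i, x₀' i)` over a field, EVERY local
factor `ρ i` is isomorphic to `ρ' i` (`∃` an intertwining linear equivalence — no control of base vectors), and for almost
all `i` the base vectors are non-zero and the `K i`-fixed line of `ρ' i` is one-dimensional, then `π ≅ π'` equivariantly
(choose the local equivalences, then `exists_equiv_of_forall_equiv_of_finrank_fixedPoints_eq_one`).
[cite: Flath1979, §2 Example 2] [cite: Flath1979, §2 Remark following Example 2] -/
theorem IsRestrictedTensorProductRep.exists_equiv_of_forall_exists_equiv_of_finrank_fixedPoints_eq_one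
    (h : IsRestrictedTensorProductRep ρ π hx₀ j S₀) (h' : IsRestrictedTensorProductRep ρ' π' hx₀' j' S₀')
    (hiso : ∀ i, ∃ f : V i ≃ₗ[k] V' i, ∀ (g : G i) (v : V i), f (ρ i g v) = ρ' i g (f v))
    (hx₀ne : ∀ᶠ i in cofinite, x₀ i ≠ 0) (hx₀'ne : ∀ᶠ i in cofinite, x₀' i ≠ 0)
    (hrank : ∀ᶠ i in cofinite, Module.finrank k ((ρ' i).fixedPoints (K i)) = 1) :
    ∃ E : W ≃ₗ[k] W', ∀ g : Πʳ i, [G i, K i], (E : W →ₗ[k] W') ∘ₗ π g = π' g ∘ₗ (E : W →ₗ[k] W') := by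
  choose e he using hiso
  exact h.exists_equiv_of_forall_equiv_of_finrank_fixedPoints_eq_one h' e he hx₀ne hx₀'ne hrank

end Literature.NumberTheory.Automorphic
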